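import Literature.Geometry.Kaehler.HolomorphicChainConstantPeriods
import HarnessLib

/-!
# Periods of a `Λ`-periodic holomorphic chain over a fundamental domain of the lattice

Layer `Literature/Geometry/Kaehler`; lane `lit-hodgefound`, Layer A4, row A4-18 (b) stage (ii)
(`run/shared/lean/pub/lit-hodgefound/SKELETON.md` §P Q58, node N3 of
`lit-hodgefound-p07/Q58-STAGING.md`). A closed analytic subvariety (more generally a holomorphic
`d`-chain) `Z` of the complex torus `X = E/Λ`, `Λ = Φ(ℤ^ι)`, lifts along the universal covering
`π : E → X` to a `Λ`-PERIODIC holomorphic `d`-chain `T = π^* Z` on `E` (Lange (2023), §1.1.4: objects on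
`X` are `Λ`-periodic objects on `V`; Griffiths–Harris, Ch. 2 §6), and the period of an invariant form
`ω ∈ H^{2d}(X, ℂ) = Alt^{2d}_ℝ(E; ℂ)` over `Z` is the integral of the constant form `ω` over the part of
`T` inside a fundamental domain `D` of `Λ`:  `∫_Z ω = ∫_{reg|T| ∩ D} θ_T ω(ξ_T) d𝓗^{2d} = constPeriod T D ω`
(`HolomorphicChainConstantPeriods.lean`). This file proves that the choice of the fundamental domain
is immaterial and packages the resulting functional.

* `ComplexTorus.latticeVecHom Φ : ℤ^ι →+ E`, `ComplexTorus.periodLattice Φ : AddSubgroup E` — the period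
  lattice `Λ = Φ(ℤ^ι)` as an additive subgroup acting on `E` by translations (countable, by
  isometries: `𝓗^m` is `Λ`-invariant);
* `ComplexTorus.periodBox Φ a = Φ(∏ᵢ [aᵢ, aᵢ + 1))` and **`ComplexTorus.isAddFundamentalDomain_periodBox`**:
  the half-open period parallelotope is a fundamental domain of `Λ` for EVERY measure on `E` (every
  point has exactly one `Λ`-translate in the box: `toIcoDiv` coordinatewise — Lange (2023), §1.1.1:
  `X` is the period parallelotope with opposite faces identified); `measurableSet_periodBox`,
  `periodBox_subset_closedPeriodBox`, `isCompact_closedPeriodBox`;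
* `HolomorphicChain.IsLatticePeriodic Φ T` — the data `(reg|T|, θ_T, ξ_T)` of the chain are
  `Λ`-periodic (the shape of a lifted chain `π^* Z`);
* **`HolomorphicChain.IsLatticePeriodic.constPeriod_eq`** — for a `Λ`-periodic chain the period
  functional `constPeriod T D` is THE SAME for all admissible fundamental domains `D` of `Λ` (Mathlib's
  `IsAddFundamentalDomain.setIntegral_eq` for the `Λ`-invariant measure `𝓗^{2d} ⌞ reg|T|` and the
  `Λ`-invariant integrand `θ_T ω(ξ_T)`);
* `HolomorphicChain.torusPeriod Φ T : Alt^{2d}_ℝ(E; ℂ) →ₗ[ℂ] ℂ` — **the period functional `ω ↦ ∫_Z ω` of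
  the cycle `Z = T/Λ` on the invariant forms of the torus**, defined over the standard box `Φ([0,1)^ι)`
  (admissible by Lelong's theorem: `torusPeriod_apply`), equal to the period over any admissible
  fundamental domain (`IsLatticePeriodic.torusPeriod_eq_constPeriod`), killing the off-type forms
  (`torusPeriod_eq_zero_of_isOfTypeAt`, Voisin (11.6));
* **`ComplexTorus.isOfTypeAt_poincareDualForm_torusPeriod`** — its Poincaré dual form
  `[Z] := (torusPeriod Φ T)^♭ ∈ H^{2p}(X, ℂ)` (`2d + 2p = rk Λ`) is of type `(p, p)` (Voisin (2002),
  Prop. 11.20), unconditionally; and `poincareDualForm_torusPeriod_mem_integralHodgeClasses`: an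
  INTEGRAL HODGE CLASS as soon as the periods `∫_Z η`, `η ∈ H^{2d}(X, ℤ)`, are integers (the remaining
  input, `[Z] ∈ H_{2d}(X, ℤ)`: node N5 of the staging document).

Definitions with bodies and theorems; no named fact. The lift `Z ↦ π^* Z` itself (that the lifted
data are `Λ`-periodic) is node N3′ and is not constructed here.

## References

* [Lange2023AbelianVarietiesComplex] H. Lange, *Abelian Varieties over the Complex Numbers*, Springer
  (2023), §1.1.1 (period parallelotope), §1.1.4 Prop. 1.1.20, §6.2.1 Lemma 6.2.7, §6.2.4.
* [VoisinHodgeI2002] C. Voisin, *Hodge Theory and Complex Algebraic Geometry I*, CUP (2002), §11.1.2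
  Cor. 11.15, §11.1.3 Prop. 11.20, Thm. 11.21, (11.6).
* [Chirka1989] E. M. Chirka, *Complex Analytic Sets*, Kluwer (1989), §14.1.
-/

noncomputable section

open scoped Manifold ENNReal NNReal Pointwise
open MeasureTheory TopologicalSpace Set Function Complex
open Literature.Analysis.Complex (IsOfTypeAt)
open Literature.Geometry.GeometricMeasureTheory

namespace Literature.Geometry.Kaehler

-- Nested operator-norm instances on `Covector V m` / `Multivector V m`, as in `Currents.lean`.
set_option maxSynthPendingDepth 2

/-! ### The period lattice as an additive subgroup of `E`, and the period box -/

namespace ComplexTorus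

section Lattice

variable {ι : Type*} {E : Type*} [NormedAddCommGroup E] [NormedSpace ℂ E] (Φ : (ι → ℝ) ≃L[ℝ] E)

/-- The lattice map `ℤ^ι →+ E`, `m ↦ Φ(m)` (`latticeVec` as a group homomorphism).
[cite: Lange2023AbelianVarietiesComplex, §1.1.1] -/
def latticeVecHom : (ι → ℤ) →+ E where
  toFun := latticeVec Φ
  map_zero' := by
    simp only [latticeVec, Pi.zero_apply, Int.cast_zero]
    exact map_zero Φ
  map_add' m m' := by
    simp only [latticeVec, ← map_add]
    congr 1
    funext i
    simp

/-- `latticeVecHom Φ m = latticeVec Φ m`. [cite: Lange2023AbelianVarietiesComplex, §1.1.1] -/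
@[simp] theorem latticeVecHom_apply (m : ι → ℤ) : latticeVecHom Φ m = latticeVec Φ m := rfl

/-- **The period lattice** `Λ = Φ(ℤ^ι) ⊂ E` of the torus `X = E/Λ`, as an additive subgroup of `E`
(acting on `E` by translations). [cite: Lange2023AbelianVarietiesComplex, §1.1.1] -/
def periodLattice : AddSubgroup E := (latticeVecHom Φ).range

/-- `x ∈ Λ ↔ x = Φ(m)` for some `m ∈ ℤ^ι`. [cite: Lange2023AbelianVarietiesComplex, §1.1.1] -/
theorem mem_periodLattice_iff {x : E} : x ∈ periodLattice Φ ↔ ∃ m : ι → ℤ, latticeVec Φ m = x :=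
  AddMonoidHom.mem_range

/-- Lattice vectors belong to the period lattice. [cite: Lange2023AbelianVarietiesComplex, §1.1.1] -/
theorem latticeVec_mem_periodLattice (m : ι → ℤ) : latticeVec Φ m ∈ periodLattice Φ :=
  (mem_periodLattice_iff Φ).2 ⟨m, rfl⟩

/-- As a set, `Λ = range (latticeVec Φ)`. [cite: Lange2023AbelianVarietiesComplex, §1.1.1] -/
theorem coe_periodLattice : (periodLattice Φ : Set E) = Set.range (latticeVec Φ) :=
  AddMonoidHom.coe_range _

/-- The period lattice is countable. [folklore] -/
instance countable_periodLattice [Finite ι] : Countable (periodLattice Φ) := by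
  have h : (periodLattice Φ : Set E).Countable := by
    rw [coe_periodLattice]; exact Set.countable_range _
  exact h.to_subtype

/-- The lattice acts on `E` by isometries (translations). [folklore] -/
instance isIsometricVAdd_periodLattice : IsIsometricVAdd (periodLattice Φ) E :=
  ⟨fun g ↦ (isometry_vadd E (g : E) : _)⟩

/-- The translation action of a lattice element: `λ +ᵥ x = λ + x`. [cite: Lange2023AbelianVarietiesComplex, §1.1.1] -/
theorem periodLattice_vadd (g : periodLattice Φ) (x : E) : g +ᵥ x = (g : E) + x := rfl

/-- **The period box** with corner `Φ(a)`: the half-open parallelotope `Φ(∏ᵢ [aᵢ, aᵢ + 1))`, a set of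
representatives of `E/Λ` (Lange (2023), §1.1.1: the torus is the period parallelotope with opposite
faces identified). [cite: Lange2023AbelianVarietiesComplex, §1.1.1] -/
def periodBox (a : ι → ℝ) : Set E := Φ '' Set.pi Set.univ fun i ↦ Set.Ico (a i) (a i + 1)

/-- The closed period parallelotope `Φ(∏ᵢ [aᵢ, aᵢ + 1])`. [cite: Lange2023AbelianVarietiesComplex, §1.1.1] -/
def closedPeriodBox (a : ι → ℝ) : Set E := Φ '' Set.pi Set.univ fun i ↦ Set.Icc (a i) (a i + 1)

/-- Membership in the period box, in coordinates. [cite: Lange2023AbelianVarietiesComplex, §1.1.1] -/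
theorem mem_periodBox_iff {a : ι → ℝ} {x : E} :
    x ∈ periodBox Φ a ↔ ∀ i, Φ.symm x i ∈ Set.Ico (a i) (a i + 1) := by
  rw [periodBox, ContinuousLinearEquiv.image_eq_preimage_symm, mem_preimage, mem_univ_pi]

/-- The period box lies in the closed parallelotope. [cite: Lange2023AbelianVarietiesComplex, §1.1.1] -/
theorem periodBox_subset_closedPeriodBox (a : ι → ℝ) : periodBox Φ a ⊆ closedPeriodBox Φ a :=
  image_mono (pi_mono fun _ _ ↦ Ico_subset_Icc_self)

/-- The closed period parallelotope is compact. [cite: Lange2023AbelianVarietiesComplex, §1.1.1] -/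
theorem isCompact_closedPeriodBox (a : ι → ℝ) : IsCompact (closedPeriodBox Φ a) :=
  (isCompact_univ_pi fun _ ↦ isCompact_Icc).image Φ.continuous

variable [Fintype ι] [MeasurableSpace E] [BorelSpace E]

/-- The period box is a Borel set. [cite: Lange2023AbelianVarietiesComplex, §1.1.1] -/
theorem measurableSet_periodBox (a : ι → ℝ) : MeasurableSet (periodBox Φ a) := by
  rw [periodBox, ContinuousLinearEquiv.image_eq_preimage_symm]
  exact (MeasurableSet.univ_pi fun i ↦ measurableSet_Ico).preimage Φ.symm.continuous.measurable

/-- **The period box is a fundamental domain of `Λ` for every measure on `E`**: every point of `E` has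
exactly one `Λ`-translate in `Φ(∏ᵢ [aᵢ, aᵢ + 1))` (coordinatewise Euclidean division, `toIcoDiv`).
[cite: Lange2023AbelianVarietiesComplex, §1.1.1] -/
theorem isAddFundamentalDomain_periodBox (a : ι → ℝ) (μ : Measure E) :
    IsAddFundamentalDomain (periodLattice Φ) (periodBox Φ a) μ := by
  refine IsAddFundamentalDomain.mk' (measurableSet_periodBox Φ a).nullMeasurableSet fun x ↦ ?_
  -- the integer vector putting `x` into the box
  set y : ι → ℝ := Φ.symm x with hy
  set m₀ : ι → ℤ := fun i ↦ -toIcoDiv zero_lt_one (a i) (y i) with hm₀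
  have key : ∀ m : ι → ℤ, latticeVec Φ m + x ∈ periodBox Φ a ↔ m = m₀ := by
    intro m
    rw [mem_periodBox_iff]
    have hcoord : ∀ i, Φ.symm (latticeVec Φ m + x) i = y i - (-m i) • (1 : ℝ) := fun i ↦ by
      simp [latticeVec, hy, add_comm]
    simp_rw [hcoord]
    constructor
    · intro h
      funext i
      have hi := h i
      rw [show a i + 1 = a i + (1 : ℝ) from rfl] at hi
      have := toIcoDiv_eq_of_sub_zsmul_mem_Ico (hp := zero_lt_one) hi
      simp [hm₀, this]
    · rintro rfl i
      have h := sub_toIcoDiv_zsmul_mem_Ico zero_lt_one (a i) (y i)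
      simpa [hm₀] using h
  refine ⟨⟨latticeVec Φ m₀, latticeVec_mem_periodLattice Φ m₀⟩, (key m₀).2 rfl, ?_⟩
  rintro ⟨g, hg⟩ hgx
  obtain ⟨m, rfl⟩ := (mem_periodLattice_iff Φ).1 hg
  have hm : m = m₀ := (key m).1 hgx
  subst hm
  rfl

end Lattice

end ComplexTorus

/-! ### Invariant measures restricted to invariant sets -/

/-- A `G`-invariant measure restricted to a measurable `G`-invariant set is `G`-invariant. [folklore] -/
private theorem vaddInvariantMeasure_restrict {G α : Type*} [AddGroup G] [AddAction G α]
    [MeasurableSpace α] [MeasurableConstVAdd G α] {μ : Measure α} [VAddInvariantMeasure G α μ]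
    {s : Set α} (hs : MeasurableSet s) (hinv : ∀ g : G, (fun x ↦ g +ᵥ x) ⁻¹' s = s) :
    VAddInvariantMeasure G α (μ.restrict s) := by
  refine ⟨fun g t ht ↦ ?_⟩
  have hgt : MeasurableSet ((fun x ↦ g +ᵥ x) ⁻¹' t) := measurable_const_vadd g ht
  rw [Measure.restrict_apply hgt, Measure.restrict_apply ht]
  conv_lhs => rw [← hinv g, ← preimage_inter]
  exact VAddInvariantMeasure.measure_preimage_vadd g (ht.inter hs)

/-! ### `Λ`-periodic chains -/

namespace HolomorphicChain

variable {ι : Type*} {E : Type*} [NormedAddCommGroup E] [InnerProductSpace ℂ E] [MeasurableSpace E]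
  [BorelSpace E] (Φ : (ι → ℝ) ≃L[ℝ] E) {Ω : Opens E} {p : ℕ}

/-- **`Λ`-periodicity of a holomorphic chain on `E`** (`Λ = Φ(ℤ^ι)`): its carrier `reg|T|`, density
`θ_T` and orientation frame `ξ_T` are invariant under the translations by lattice vectors — the shape
of the lift `π^* Z` to the universal cover of an analytic cycle `Z` of the torus `X = E/Λ` (Lange
(2023), §1.1.4: objects on `X` are the `Λ`-periodic objects on `V`).
[cite: Lange2023AbelianVarietiesComplex, §1.1.4] -/
structure IsLatticePeriodic (T : HolomorphicChain 𝓘(ℂ, E) Ω p) : Prop where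
  /-- `reg|T| + λ = reg|T|` -/
  mem_carrier_iff : ∀ (m : ι → ℤ) (x : E), ComplexTorus.latticeVec Φ m + x ∈ T.carrier ↔ x ∈ T.carrier
  /-- `θ_T(x + λ) = θ_T(x)` -/
  density_add : ∀ (m : ι → ℤ) (x : E), T.density (ComplexTorus.latticeVec Φ m + x) = T.density x
  /-- `ξ_T(x + λ) = ξ_T(x)` -/
  orientationFrame_add : ∀ (m : ι → ℤ) (x : E),
    T.orientationFrame (ComplexTorus.latticeVec Φ m + x) = T.orientationFrame x

namespace IsLatticePeriodic

variable {Φ} {T : HolomorphicChain 𝓘(ℂ, E) Ω p}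

/-- The carrier of a periodic chain is `Λ`-invariant. [cite: Lange2023AbelianVarietiesComplex, §1.1.4] -/
theorem preimage_carrier (hT : T.IsLatticePeriodic Φ) (g : ComplexTorus.periodLattice Φ) :
    (fun x ↦ g +ᵥ x) ⁻¹' T.carrier = T.carrier := by
  obtain ⟨m, hm⟩ := (ComplexTorus.mem_periodLattice_iff Φ).1 g.2
  ext x
  rw [mem_preimage, ComplexTorus.periodLattice_vadd, ← hm]
  exact hT.mem_carrier_iff m x

/-- The integrand `θ_T ω(ξ_T)` of a periodic chain at a constant form is `Λ`-invariant.
[cite: Lange2023AbelianVarietiesComplex, §1.1.4] -/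
theorem integrand_vadd (hT : T.IsLatticePeriodic Φ) (ω : E [⋀^Fin (2 * p)]→L[ℝ] ℂ)
    (g : ComplexTorus.periodLattice Φ) (x : E) :
    ((T.density (g +ᵥ x) : ℝ) : ℂ) * ω (T.orientationFrame (g +ᵥ x)) =
      ((T.density x : ℝ) : ℂ) * ω (T.orientationFrame x) := by
  obtain ⟨m, hm⟩ := (ComplexTorus.mem_periodLattice_iff Φ).1 g.2
  rw [ComplexTorus.periodLattice_vadd, ← hm, hT.density_add, hT.orientationFrame_add]

variable [FiniteDimensional ℂ E]

/-- **`𝓗^{2p} ⌞ reg|T|` is `Λ`-invariant** for a periodic chain (Hausdorff measure is translation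
invariant and the carrier is periodic). [cite: Lange2023AbelianVarietiesComplex, §1.1.4] -/
theorem vaddInvariantMeasure (hT : T.IsLatticePeriodic Φ) :
    VAddInvariantMeasure (ComplexTorus.periodLattice Φ) E
      ((μHE[2 * p] : Measure E).restrict T.carrier) :=
  letI : InnerProductSpace ℝ E := InnerProductSpace.complexToReal
  vaddInvariantMeasure_restrict T.isRectifiableData.1 hT.preimage_carrier

variable [Fintype ι]

/-- **Independence of the fundamental domain.** For a `Λ`-periodic holomorphic `p`-chain `T` on `E` and
two fundamental domains `D`, `D'` of `Λ` (for `𝓗^{2p} ⌞ reg|T|`) on which the vector density is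
integrable, the periods on constant forms agree: `constPeriod T D = constPeriod T D'` — the integral
`∫_Z ω` over the cycle `Z = T/Λ` of the torus does not depend on the set of representatives
(Mathlib's `IsAddFundamentalDomain.setIntegral_eq`). [cite: Lange2023AbelianVarietiesComplex, §1.1.4] -/
theorem constPeriod_eq (hT : T.IsLatticePeriodic Φ) {D D' : Set E}
    (hD : IsAddFundamentalDomain (ComplexTorus.periodLattice Φ) D
      ((μHE[2 * p] : Measure E).restrict T.carrier))
    (hD' : IsAddFundamentalDomain (ComplexTorus.periodLattice Φ) D'
      ((μHE[2 * p] : Measure E).restrict T.carrier))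
    (hDi : IntegrableOn (fun x ↦ (T.density x : ℝ) • frameVector (T.orientationFrame x)) D
      ((μHE[2 * p] : Measure E).restrict T.carrier))
    (hD'i : IntegrableOn (fun x ↦ (T.density x : ℝ) • frameVector (T.orientationFrame x)) D'
      ((μHE[2 * p] : Measure E).restrict T.carrier)) :
    T.constPeriod D = T.constPeriod D' := by
  haveI := hT.vaddInvariantMeasure
  ext ω
  rw [T.constPeriod_apply hDi, T.constPeriod_apply hD'i]
  exact hD.setIntegral_eq hD' (hT.integrand_vadd ω)

end IsLatticePeriodic

/-! ### The period functional of the cycle `T/Λ` on the invariant forms of the torus -/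

/-- **The period functional of a holomorphic `p`-chain `T` on `E` modulo `Λ`**, on the invariant
`2p`-forms `Alt^{2p}_ℝ(E; ℂ) = H^{2p}(X, ℂ)` of the torus `X = E/Λ`: `ω ↦ ∫_{reg|T| ∩ Φ([0,1)^ι)} θ_T ω(ξ_T) d𝓗^{2p}`,
the period over the standard period box — for the lift `T = π^* Z` of an analytic cycle `Z ⊂ X` the
integration current `ω ↦ ∫_Z ω` of `Z` on invariant forms (Voisin (2002), Cor. 11.15 / Thm. 11.21),
independent of the fundamental domain (`IsLatticePeriodic.torusPeriod_eq_constPeriod`).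
[cite: VoisinHodgeI2002, §11.1.2 Cor. 11.15] -/
def torusPeriod (T : HolomorphicChain 𝓘(ℂ, E) (⊤ : Opens E) p) : (E [⋀^Fin (2 * p)]→L[ℝ] ℂ) →ₗ[ℂ] ℂ :=
  T.constPeriod (ComplexTorus.periodBox Φ 0)

/-- `torusPeriod Φ T = constPeriod T (periodBox Φ 0)`. [cite: VoisinHodgeI2002, §11.1.2 Cor. 11.15] -/
theorem torusPeriod_def (T : HolomorphicChain 𝓘(ℂ, E) (⊤ : Opens E) p) :
    T.torusPeriod Φ = T.constPeriod (ComplexTorus.periodBox Φ 0) := rfl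

variable [FiniteDimensional ℂ E]

/-- The vector density of a chain on all of `E` is integrable on every period box (Lelong: the box lies
in the compact closed parallelotope). [cite: Harvey1977, Lemma 1.3] -/
theorem integrableOn_density_smul_frameVector_periodBox (T : HolomorphicChain 𝓘(ℂ, E) (⊤ : Opens E) p)
    (a : ι → ℝ) :
    IntegrableOn (fun x ↦ (T.density x : ℝ) • frameVector (T.orientationFrame x))
      (ComplexTorus.periodBox Φ a) ((μHE[2 * p] : Measure E).restrict T.carrier) :=
  T.integrableOn_density_smul_frameVector_of_subset_isCompact
    (ComplexTorus.periodBox_subset_closedPeriodBox Φ a) (ComplexTorus.isCompact_closedPeriodBox Φ a)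
    (fun _ _ ↦ trivial)

/-- **`torusPeriod Φ T ω = ∫_{reg|T| ∩ Φ([0,1)^ι)} θ_T ω(ξ_T) d𝓗^{2p}`** — an honest integral, the box being
admissible by Lelong's theorem. [cite: VoisinHodgeI2002, §11.1.2 Cor. 11.15] -/
theorem torusPeriod_apply (T : HolomorphicChain 𝓘(ℂ, E) (⊤ : Opens E) p) (ω : E [⋀^Fin (2 * p)]→L[ℝ] ℂ) :
    T.torusPeriod Φ ω = ∫ x in ComplexTorus.periodBox Φ 0,
      ((T.density x : ℝ) : ℂ) * ω (T.orientationFrame x) ∂((μHE[2 * p] : Measure E).restrict T.carrier) :=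
  T.constPeriod_apply (T.integrableOn_density_smul_frameVector_periodBox Φ 0) ω

/-- **The period functional kills the off-type invariant forms** (Voisin (11.6): the current of an
analytic cycle has bidimension `(p, p)`). [cite: VoisinHodgeI2002, §11.1.3 Thm. 11.21 and (11.6)] -/
theorem torusPeriod_eq_zero_of_isOfTypeAt (T : HolomorphicChain 𝓘(ℂ, E) (⊤ : Opens E) p)
    {ω : E [⋀^Fin (2 * p)]→L[ℝ] ℂ} {r s : ℕ} (hω : IsOfTypeAt r s ω) (hrs : r ≠ s) :
    T.torusPeriod Φ ω = 0 :=
  T.constPeriod_eq_zero_of_isOfTypeAt _ hω hrs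

/-- The period of a real invariant form is real. [cite: Chirka1989, §14.1 Cor., p. 174] -/
theorem torusPeriod_ofReal (T : HolomorphicChain 𝓘(ℂ, E) (⊤ : Opens E) p) (φ : E [⋀^Fin (2 * p)]→L[ℝ] ℝ) :
    T.torusPeriod Φ (ofRealCLM.compContinuousAlternatingMap φ) =
      ((∫ x in ComplexTorus.periodBox Φ 0, (T.density x : ℝ) * φ (T.orientationFrame x)
        ∂((μHE[2 * p] : Measure E).restrict T.carrier) : ℝ) : ℂ) :=
  T.constPeriod_ofReal (T.integrableOn_density_smul_frameVector_periodBox Φ 0) φ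

section FundamentalDomain

variable {Φ} [Fintype ι]

/-- **The period functional does not depend on the fundamental domain**: for a `Λ`-periodic chain,
`torusPeriod Φ T = constPeriod T D` for every fundamental domain `D` of `Λ` (for `𝓗^{2p} ⌞ reg|T|`) on
which the vector density is integrable — e.g. every period box `Φ(a + [0,1)^ι)`
(`torusPeriod_eq_constPeriod_periodBox`). [cite: Lange2023AbelianVarietiesComplex, §1.1.4] -/
theorem IsLatticePeriodic.torusPeriod_eq_constPeriod {T : HolomorphicChain 𝓘(ℂ, E) (⊤ : Opens E) p}
    (hT : T.IsLatticePeriodic Φ) {D : Set E}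
    (hD : IsAddFundamentalDomain (ComplexTorus.periodLattice Φ) D
      ((μHE[2 * p] : Measure E).restrict T.carrier))
    (hDi : IntegrableOn (fun x ↦ (T.density x : ℝ) • frameVector (T.orientationFrame x)) D
      ((μHE[2 * p] : Measure E).restrict T.carrier)) :
    T.torusPeriod Φ = T.constPeriod D :=
  hT.constPeriod_eq (ComplexTorus.isAddFundamentalDomain_periodBox Φ 0 _) hD
    (T.integrableOn_density_smul_frameVector_periodBox Φ 0) hDi

/-- In particular all period boxes give the same periods. [cite: Lange2023AbelianVarietiesComplex, §1.1.4] -/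
theorem IsLatticePeriodic.torusPeriod_eq_constPeriod_periodBox {T : HolomorphicChain 𝓘(ℂ, E) (⊤ : Opens E) p}
    (hT : T.IsLatticePeriodic Φ) (a : ι → ℝ) :
    T.torusPeriod Φ = T.constPeriod (ComplexTorus.periodBox Φ a) :=
  hT.torusPeriod_eq_constPeriod (ComplexTorus.isAddFundamentalDomain_periodBox Φ a _)
    (T.integrableOn_density_smul_frameVector_periodBox Φ a)

end FundamentalDomain

end HolomorphicChain

/-! ### The class `[Z] := (∫_Z ·)^♭` of the cycle: type `(p, p)`, and integrality transfer -/

namespace ComplexTorus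

variable {ι : Type*} [Fintype ι] [DecidableEq ι] {E : Type*} [NormedAddCommGroup E]
  [InnerProductSpace ℂ E] [FiniteDimensional ℂ E] [MeasurableSpace E] [BorelSpace E]
  (Φ : (ι → ℝ) ≃L[ℝ] E) {n k : ℕ} (e : Fin n ≃ ι) {d : ℕ}

/-- **The Poincaré dual form of the period functional of a chain modulo `Λ` is of type `(p, p)`**
(`2d + k = rk Λ`, `p + p = k`): Voisin (2002), Prop. 11.20, for the constant forms of the torus, with no
hypothesis on the chain. [cite: VoisinHodgeI2002, §11.1.3 Prop. 11.20] -/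
theorem isOfTypeAt_poincareDualForm_torusPeriod (h : 2 * d + k = n) {p : ℕ} (hk : p + p = k)
    (T : HolomorphicChain 𝓘(ℂ, E) (⊤ : Opens E) d) :
    IsOfTypeAt p p (poincareDualForm Φ e h (T.torusPeriod Φ)) :=
  isOfTypeAt_poincareDualForm_constPeriod Φ e h hk T _

/-- **… an integral Hodge class when the periods are integral**: if `∫_Z η ∈ ℤ` for every
`η ∈ H^{2d}(X, ℤ) = integralForms Φ (2d)` (the cycle has an integral fundamental class — node N5), then
`[Z] = (torusPeriod Φ T)^♭ ∈ integralHodgeClasses Φ p = H^{2p}(X, ℤ) ∩ H^{p,p}` (Voisin (2002), Prop. 11.20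
as printed). [cite: VoisinHodgeI2002, §11.1.3 Prop. 11.20] -/
theorem poincareDualForm_torusPeriod_mem_integralHodgeClasses {p : ℕ} (h : 2 * d + 2 * p = n)
    (T : HolomorphicChain 𝓘(ℂ, E) (⊤ : Opens E) d)
    (hZ : ∀ η ∈ integralForms Φ (2 * d), ∃ z : ℤ, T.torusPeriod Φ η = z) :
    poincareDualForm Φ e h (T.torusPeriod Φ) ∈ integralHodgeClasses Φ p :=
  poincareDualForm_constPeriod_mem_integralHodgeClasses Φ e h T _ hZ

/-- … and hence a Hodge class (Lange (2023), Lemma 6.2.7). [cite: Lange2023AbelianVarietiesComplex, §6.2.1 Lemma 6.2.7] -/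
theorem poincareDualForm_torusPeriod_mem_hodgeClasses {p : ℕ} (h : 2 * d + 2 * p = n)
    (T : HolomorphicChain 𝓘(ℂ, E) (⊤ : Opens E) d)
    (hZ : ∀ η ∈ integralForms Φ (2 * d), ∃ z : ℤ, T.torusPeriod Φ η = z) :
    poincareDualForm Φ e h (T.torusPeriod Φ) ∈ hodgeClasses Φ p :=
  poincareDualForm_constPeriod_mem_hodgeClasses Φ e h T _ hZ

end ComplexTorus

end Literature.Geometry.Kaehler

end
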